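import Summits.BirchSwinnertonDyer.BirchSwinnertonDyer.Theorems.ByReductionTypeAtTwoAdditiveKatoTransportQuadraticLayerModel
import Summits.BirchSwinnertonDyer.Rank1Residual.Additive.SplitMultiplicativeBaseChange
import Literature.NumberTheory.EllipticCurves.Greenberg1999.SelmerCotorsionMultiplicative
import Literature.NumberTheory.EllipticCurves.BSDSelmerSkinnerThmBProofs
import Literature.NumberTheory.EllipticCurves.ModularParametrizationBCDTProofs
import Literature.NumberTheory.EllipticCurves.QuadraticTwistJInvariantProofs
import HarnessLib

/-!
# Route ByReductionTypeAtTwo, crux `AdditivePotMultOverKAtTwo` (stmt-BirchSwinnertonDyer-22618) — the (−1)-split-twist-block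
# PRINT-EXACT FE doors with the model identification, `hF`, `hmult′` and the torsion of `X(W′/ℚ_∞)` ALL DISCHARGED:
# what is displayed is PRINT (Kato 12.4, Greenberg 1.14 ×2, Greenberg 1.5) + the ONE typed input + `X(W/ℚ_∞)` torsion

Cell `bsd-2adic`, seat `bsd-2adic-t42` GEN 24, sequel of `…AdditiveKatoTransportQuadraticLayerModel` (the model identification
`ΘS` constructed). HONEST FRAMING (D-0036 / D-0054): theorems only; types-the-object-of → shrinks-literal on the (−1)-block doors;
closes none; nothing booked; BSD is not proved by any of this. PARTITION: X5@2 additive, C4″ 22618 (−1)-split-twist block × `p = 2`.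

* §1 twist bookkeeping from `hV : V • W = W′^{(−1)}`: `∃ C, C • W′ = W^{(−1)}` (`quadraticTwist_smul`, `quadraticTwist_quadraticTwist`,
  `exists_variableChange_smul_eq_quadraticTwist_sq`); hence `W′` is split multiplicative at `2` iff `W^{(−1)}` is
  (`hasSplitMultiplicativeReductionAtPrime_smul_iff`) and the newform of `W^{(−1)}` is the newform of `W′` (`IsNewformOf.of_smul`).
* §2 `hasSplitMultiplicativeReductionAt_baseChange_of_two_mem` — the binder `hF` of the `_of_quadraticField` doors IN THE KERNEL:
  `W′` globally minimal and split multiplicative at `2` ⟹ `W′ ⊗ F` split multiplicative at every place of `F` above `2`, ANY number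
  field `F` (b2b-bsdres `hasSplitMultiplicativeReductionAt_baseChange_of_hasSplitMultiplicativeReductionAtPrime`; `2` ramifies in
  `ℚ(i)` — irrelevant).
* §3 the doors with PRINT inputs: **`lengthAt_selmerDual_symm_of_quadraticField_print`** (T20 (a) BY NAME ⟸ Greenberg 1.14 ×2 +
  Greenberg 1.5 (h15, `X(W′/ℚ_∞)` torsion) + `X(W/ℚ_∞)` torsion + the field data), and the two PRINT-EXACT FE doors
  **`lengthAt_selmerDualContra_le_of_oddBranchInputsPrintExact_fe_of_quadraticField_print`** (key `γ⁻¹`) /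
  **`lengthAt_selmerDual_le_of_oddBranchInputsPrintExact_fe_of_quadraticField_print`** (key `γ`). Compared with the
  `_of_quadraticField` doors: `hmult′`, `D₀′`, `[Module.Finite D₀′.X]`, `hD₀′`, `hF` are GONE (derived: `hsp` transported to
  `W′`; the canonical dual `W′.selmerDualData` + `module_finite_holds`; `hD₀′` from the PRINT fact
  `Greenberg1999.thm15_isTorsion_multiplicative_rat` applied to `W′` with the newform `f` of `W^{(−1)} ≅ W′`; `hF` by §2);
  added: the named fact `h15`.

References: [GreenbergLNM1716] Thm. 1.5 (p. 61), Thm. 1.14 (p. 68); [SilvermanAEC2009] VII.5 Prop. 5.1, X.5 Cor. 5.4, App. C §16;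
[Kato2004Asterisque] Thm. 12.4, 12.5 (3), §17.13; [MazurTateTeitelbaum1986Invent] §I.17; memo
`run/shared/lean/pub/bsd-2adic/t42/DESIGN-T42-ADDENDUM-28.md`.
-/

set_option autoImplicit false
-- the summit's namespace `Summit.BirchSwinnertonDyer.BirchSwinnertonDyer` (Sub = Summit) trips `dupNamespace`
set_option linter.dupNamespace false

noncomputable section

open scoped Classical MatrixGroups ModularForm NumberField

open Field CongruenceSubgroup WeierstrassCurve IsDedekindDomain
  Literature.NumberTheory.EllipticCurves Literature.NumberTheory.EllipticCurves.ModularForms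
  Literature.NumberTheory.EllipticCurves.Module Literature.NumberTheory.EllipticCurves.QuadraticLayer
  Literature.NumberTheory.GaloisRepresentations

namespace Summit.BirchSwinnertonDyer.BirchSwinnertonDyer.Theorems.AddKatoTwoQuadLayerModel

/-! ## §1 `W′ ≅ W^{(−1)}` over `ℚ` -/

section Twist

variable (W W' : WeierstrassCurve ℚ) {V : VariableChange ℚ} (hV : V • W = W'.quadraticTwist (-1))

include hV in
/-- **`W′ ≅_ℚ W^{(−1)}`** when `W ≅_ℚ W′^{(−1)}` (`V • W = W′^{(−1)}`): twisting `hV` by `−1` gives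
`C₂ • W^{(−1)} = (W′^{(−1)})^{(−1)} = W′^{(1)} = C₁ • W′`. [cite: SilvermanAEC2009, X.5 Cor. 5.4] -/
theorem exists_smul_eq_quadraticTwist_neg_one : ∃ C : VariableChange ℚ, C • W' = W.quadraticTwist (-1) := by
  have h1 := W.quadraticTwist_smul V (-1 : ℚ)
  rw [hV, quadraticTwist_quadraticTwist, show (-1 : ℚ) * (-1) = (1 : ℚ) ^ 2 by norm_num] at h1
  obtain ⟨C₁, hC₁⟩ := W'.exists_variableChange_smul_eq_quadraticTwist_sq (one_ne_zero (α := ℚ))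
  refine ⟨(⟨V.u, -1 * V.r, 0, 0⟩ : VariableChange ℚ)⁻¹ * C₁, ?_⟩
  rw [mul_smul, hC₁, h1, inv_smul_smul]

include hV in
/-- `W′` is split multiplicative at `ℓ` iff `W^{(−1)}` is (`ℚ`-isomorphism invariance of the reduction type,
`hasSplitMultiplicativeReductionAtPrime_smul_iff`). [cite: SilvermanAEC2009, VII.5 Prop. 5.1(b) and VII.1 Prop. 1.3(b)] -/
theorem hasSplitMultiplicativeReductionAtPrime_iff_of_twist [W'.IsElliptic] (ℓ : ℕ) [Fact ℓ.Prime] :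
    W'.HasSplitMultiplicativeReductionAtPrime ℓ ↔ (W.quadraticTwist (-1)).HasSplitMultiplicativeReductionAtPrime ℓ := by
  obtain ⟨C, hC⟩ := exists_smul_eq_quadraticTwist_neg_one W W' hV
  rw [← hC]
  exact (hasSplitMultiplicativeReductionAtPrime_smul_iff W' C ℓ).symm

include hV in
/-- The newform of `W^{(−1)}` is the newform of `W′` (`IsNewformOf` only sees the `L`-function, a `ℚ`-isomorphism invariant).
[cite: SilvermanAEC2009, App. C §16] -/
theorem isNewformOf_of_twist [W'.IsElliptic] {N : ℕ} [NeZero N] {f : CuspForm (Gamma0 N) 2}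
    (hf : IsNewformOf (W.quadraticTwist (-1)) f) : IsNewformOf W' f := by
  obtain ⟨C, hC⟩ := exists_smul_eq_quadraticTwist_neg_one W W' hV
  exact IsNewformOf.of_smul C (by rw [hC]; exact hf)

end Twist

/-! ## §2 `hF` in the kernel: split multiplicative reduction above `2` over any number field -/

section SplitMult

variable (W' : WeierstrassCurve ℚ) [W'.IsElliptic] [W'.IsGloballyMinimal]

/-- **The binder `hF` discharged**: for `W′/ℚ` globally minimal and split multiplicative at `2`, `W′ ⊗ F` is split multiplicative
at every place of the number field `F` above `2` (b2b-bsdres: the minimal equation stays minimal with multiplicative reduction,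
and the node-tangent quadratic splits over `𝔽₂ ⊆ k_v`). [cite: SilvermanAEC2009, VII.5 Prop. 5.1(b) and VII.1 Prop. 1.3(b)] -/
theorem hasSplitMultiplicativeReductionAt_baseChange_of_two_mem (hsp' : W'.HasSplitMultiplicativeReductionAtPrime 2)
    (F : Type) [Field F] [NumberField F] (v : HeightOneSpectrum (𝓞 F)) (hv : (2 : 𝓞 F) ∈ v.asIdeal) :
    (W'.baseChange F).HasSplitMultiplicativeReductionAt v :=
  Summit.BirchSwinnertonDyer.Rank1Residual.Additive.hasSplitMultiplicativeReductionAt_baseChange_of_hasSplitMultiplicativeReductionAtPrime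
    W' 2 v (by rw [Nat.cast_ofNat]; exact hv) hsp'

end SplitMult

/-! ## §3 The doors with PRINT inputs -/

section Symmetry

variable (h114 : Greenberg1999_thm114_charIdeal_iota_invariant)
  (h114F : Greenberg1999.thm114_charIdeal_iota_invariant_splitMult_baseChange)
  (h15 : Greenberg1999.thm15_isTorsion_multiplicative_rat)
  (W' : WeierstrassCurve ℚ) [W'.IsElliptic] [W'.IsGloballyMinimal]
  (W : WeierstrassCurve ℚ) {V : VariableChange ℚ} (hV : V • W = W'.quadraticTwist (-1))
  {θ : AlgebraicClosure ℚ} (hθ : θ ^ 2 = algebraMap ℚ (AlgebraicClosure ℚ) (-1))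
  {N : ℕ} [NeZero N] (f : CuspForm (Gamma0 N) 2) (hf : IsNewformOf (W.quadraticTwist (-1)) f)
  (hsp : (W.quadraticTwist (-1)).HasSplitMultiplicativeReductionAtPrime 2)
  (κ : ZpExtension ℚ 2) (γ : absoluteGaloisGroup ℚ) (hκ : κ.IsCyclotomic) (hγ : κ.IsTopGenerator γ) (hγθ : γ • θ = θ)
  (D : W.SelmerDualData κ γ) (hD : D.IsTorsion)

include h114 h114F h15 hV hθ hf hsp hκ hγ hγθ hD in
/-- **T20 (a) BY NAME from PRINT + the torsion of `X(W/ℚ_∞)`**: `ℓ_𝔮(X(W/ℚ_∞)) = ℓ_{ι𝔮}(X(W/ℚ_∞))` at every height-one `𝔮 ∌ 2`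
for the ADDITIVE `W` (`W ≅ W′^{(−1)}`, `W^{(−1)}` split multiplicative at `2` with newform `f`), from Greenberg's Thm 1.14 over `ℚ`
and over `F` (PRINT), Greenberg's Thm 1.5 (PRINT: `X(W′/ℚ_∞)` torsion — `W′` is multiplicative at `2` with newform `f`, §1),
the torsion of `X(W/ℚ_∞)`, and a quadratic field `F ∋ √−1` (data): `lengthAt_selmerDual_symm_of_quadraticField` with `hmult′`,
`D′`, `hD′`, `hF` SUPPLIED. [cite: GreenbergLNM1716, Thm. 1.14 (p. 68), Thm. 1.5 (p. 61)] [cite: DokchitserDokchitserAnnals2010, Lemma 4.14] -/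
theorem lengthAt_selmerDual_symm_of_quadraticField_print
    (F : Type) [Field F] [NumberField F] {θF : F} (hθF : θF ^ 2 = -1) (hF2 : Module.finrank ℚ F = 2)
    (𝔮 : PrimeSpectrum (IwasawaAlgebra 2)) (h𝔮 : 𝔮.asIdeal.height = 1) (hp𝔮 : PowerSeries.C (2 : ℤ_[2]) ∉ 𝔮.asIdeal) :
    lengthAt (IwasawaAlgebra 2) D.X 𝔮 =
      lengthAt (IwasawaAlgebra 2) D.X (PrimeSpectrum.comap (IwasawaAlgebra.invol 2).toRingHom 𝔮) := by
  haveI : Fact (Nat.Prime 2) := ⟨Nat.prime_two⟩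
  have hsp' : W'.HasSplitMultiplicativeReductionAtPrime 2 := (hasSplitMultiplicativeReductionAtPrime_iff_of_twist W W' hV 2).mpr hsp
  have hmult' : W'.HasMultiplicativeReductionAtPrime 2 := hsp'.hasMultiplicativeReductionAtPrime
  have hf' : IsNewformOf W' f := isNewformOf_of_twist W W' hV hf
  let D' : W'.SelmerDualData κ γ := W'.selmerDualData κ hγ
  haveI : Module.Finite (IwasawaAlgebra 2) D'.X := D'.module_finite_holds hγ
  have hD' : D'.IsTorsion := h15 W' 2 hmult' f hf' κ γ hκ hγ D'
  exact lengthAt_selmerDual_symm_of_quadraticField h114 h114F W' hmult' W hV hθ κ γ hκ hγ hγθ D' hD' D hD F hθF hF2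
    (fun v hv ↦ hasSplitMultiplicativeReductionAt_baseChange_of_two_mem W' hsp' F v hv) 𝔮 h𝔮 hp𝔮

end Symmetry

section PrintExactDoors

variable (h12 : Kato2004.thm12_4) (hPE : AddKatoTwo.KatoOddBranchInputsAtTwoNegOneSplitTwistPrintExact)
  (h114 : Greenberg1999_thm114_charIdeal_iota_invariant)
  (h114F : Greenberg1999.thm114_charIdeal_iota_invariant_splitMult_baseChange)
  (h15 : Greenberg1999.thm15_isTorsion_multiplicative_rat)
  -- the additive curve `W` on the (−1)-block and a globally minimal model `W′` of its twist
  (W : WeierstrassCurve ℚ) [W.IsElliptic] [W.IsGloballyMinimal] [ContinuousSMul ℤ_[2] (W.tateModule 2)]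
  (W' : WeierstrassCurve ℚ) [W'.IsElliptic] [W'.IsGloballyMinimal]
  {V : VariableChange ℚ} (hV : V • W = W'.quadraticTwist (-1))
  {θ : AlgebraicClosure ℚ} (hθ : θ ^ 2 = algebraMap ℚ (AlgebraicClosure ℚ) (-1))
  {N : ℕ} [NeZero N] (f : CuspForm (Gamma0 N) 2) (κ : ZpExtension ℚ 2) (γ : absoluteGaloisGroup ℚ)
  (hsp : (W.quadraticTwist (-1)).HasSplitMultiplicativeReductionAtPrime 2)
  (hirr : W.HasIrreducibleModPGaloisRep 2) (hκ : κ.IsCyclotomic) (hγ : κ.IsTopGenerator γ)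
  (hγ' : IsCyclotomicVariable 2 γ) (hγθ : γ • θ = θ) (hf : IsNewformOf (W.quadraticTwist (-1)) f)
  (I : Kato2004.IwasawaH1Data W 2 κ γ)
  -- torsion of the `ℚ`-side Iwasawa module of the ADDITIVE `W` (key `γ`)
  (D₀ : W.SelmerDualData κ γ) (hD₀ : D₀.IsTorsion)
  -- the `2`-adic `L`-function side
  (Lt : IwasawaAlgebra 2) (m : ℕ)
  (hLt : iwasawaToPowerSeries 2 Lt = PowerSeries.C ((2 : ℚ_[2]) ^ m) * padicLFunctionMinusBranchMult f (1 : ℚ_[2]) 1)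
  (hLt0 : Lt ≠ 0)

include h12 hPE h114 h114F h15 hV hθ hsp hirr hκ hγ hγ' hγθ hf I hD₀ hLt hLt0 in
/-- **KEY-`γ⁻¹` PRINT-EXACT DOOR, PRINT inputs**: `ℓ_𝔮(X′) ≤ ℓ_𝔮(Λ/(L̃))` at every height-one `𝔮 ∌ 2` for every key-`γ⁻¹` dual
Selmer datum `D′` of the ADDITIVE `W` (`W^{(−1)}` split multiplicative at `2` with newform `f`, `W[2]` irreducible, `W′` a globally
minimal model of `W^{(−1)}`), from: `Kato2004.thm12_4`, the PRINT-EXACT typed input, Greenberg 1.14 ×2, Greenberg 1.5 (PRINT), the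
torsion of `X(W/ℚ_∞)`, a quadratic field `F ∋ √−1` (data), `L̃ = 2^m L⁻ ≠ 0` — `…_fe_of_quadraticField` with `hmult′`, `D₀′`, `hD₀′`,
`hF` SUPPLIED (§1, §2, h15). [cite: Kato2004Asterisque, Thm. 12.4 (2) (p. 221), Thm. 12.5 (3) and (12.5.1) (p. 222), §17.13 (pp. 279–280)]
[cite: GreenbergLNM1716, Thm. 1.14 (p. 68), Thm. 1.5 (p. 61)] [cite: MazurTateTeitelbaum1986Invent, §I.17] -/
theorem lengthAt_selmerDualContra_le_of_oddBranchInputsPrintExact_fe_of_quadraticField_print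
    (F : Type) [Field F] [NumberField F] {θF : F} (hθF : θF ^ 2 = -1) (hF2 : Module.finrank ℚ F = 2)
    (D' : W.SelmerDualData κ γ⁻¹)
    (𝔮 : PrimeSpectrum (IwasawaAlgebra 2)) (h𝔮 : 𝔮.asIdeal.height = 1) (hp𝔮 : PowerSeries.C (2 : ℤ_[2]) ∉ 𝔮.asIdeal) :
    lengthAt (IwasawaAlgebra 2) D'.X 𝔮 ≤ lengthAt (IwasawaAlgebra 2) (IwasawaAlgebra 2 ⧸ Ideal.span {Lt}) 𝔮 := by
  haveI : Fact (Nat.Prime 2) := ⟨Nat.prime_two⟩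
  have hsp' : W'.HasSplitMultiplicativeReductionAtPrime 2 := (hasSplitMultiplicativeReductionAtPrime_iff_of_twist W W' hV 2).mpr hsp
  have hmult' : W'.HasMultiplicativeReductionAtPrime 2 := hsp'.hasMultiplicativeReductionAtPrime
  have hf' : IsNewformOf W' f := isNewformOf_of_twist W W' hV hf
  let D₀' : W'.SelmerDualData κ γ := W'.selmerDualData κ hγ
  haveI : Module.Finite (IwasawaAlgebra 2) D₀'.X := D₀'.module_finite_holds hγ
  have hD₀' : D₀'.IsTorsion := h15 W' 2 hmult' f hf' κ γ hκ hγ D₀'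
  exact lengthAt_selmerDualContra_le_of_oddBranchInputsPrintExact_fe_of_quadraticField h12 hPE h114 h114F W W' hmult' hV hθ f κ γ
    hsp hirr hκ hγ hγ' hγθ hf I D₀' hD₀' D₀ hD₀ Lt m hLt hLt0 F hθF hF2
    (fun v hv ↦ hasSplitMultiplicativeReductionAt_baseChange_of_two_mem W' hsp' F v hv) D' 𝔮 h𝔮 hp𝔮

include h12 hPE h114 h114F h15 hV hθ hsp hirr hκ hγ hγ' hγθ hf I hD₀ hLt hLt0 in
/-- **KEY-`γ` DOOR, PRINT inputs**: `ℓ_𝔮(X(W/ℚ_∞)) ≤ ℓ_𝔮(Λ/(L̃))` at every height-one `𝔮 ∌ 2` for every key-`γ` dual Selmer datum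
`D` of the additive `W` — `…_fe_of_quadraticField` with `hmult′`, `D₀′`, `hD₀′`, `hF` SUPPLIED. What is displayed beyond the class
data: PRINT {Kato 12.4, Greenberg 1.14 over `ℚ`, Greenberg 1.14 over `F` (split mult), Greenberg 1.5 (mult, `F = ℚ`)}, the ONE typed
input `KatoOddBranchInputsAtTwoNegOneSplitTwistPrintExact`, and `hD₀ : X(W/ℚ_∞)` torsion.
[cite: Kato2004Asterisque, Thm. 12.4 (2) (p. 221), Thm. 12.5 (3) and (12.5.1) (p. 222), §17.13 (pp. 279–280)]
[cite: GreenbergLNM1716, Thm. 1.14 (p. 68), Thm. 1.5 (p. 61)] [cite: MazurTateTeitelbaum1986Invent, §I.17] -/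
theorem lengthAt_selmerDual_le_of_oddBranchInputsPrintExact_fe_of_quadraticField_print
    (F : Type) [Field F] [NumberField F] {θF : F} (hθF : θF ^ 2 = -1) (hF2 : Module.finrank ℚ F = 2)
    (D : W.SelmerDualData κ γ)
    (𝔮 : PrimeSpectrum (IwasawaAlgebra 2)) (h𝔮 : 𝔮.asIdeal.height = 1) (hp𝔮 : PowerSeries.C (2 : ℤ_[2]) ∉ 𝔮.asIdeal) :
    lengthAt (IwasawaAlgebra 2) D.X 𝔮 ≤ lengthAt (IwasawaAlgebra 2) (IwasawaAlgebra 2 ⧸ Ideal.span {Lt}) 𝔮 := by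
  haveI : Fact (Nat.Prime 2) := ⟨Nat.prime_two⟩
  have hsp' : W'.HasSplitMultiplicativeReductionAtPrime 2 := (hasSplitMultiplicativeReductionAtPrime_iff_of_twist W W' hV 2).mpr hsp
  have hmult' : W'.HasMultiplicativeReductionAtPrime 2 := hsp'.hasMultiplicativeReductionAtPrime
  have hf' : IsNewformOf W' f := isNewformOf_of_twist W W' hV hf
  let D₀' : W'.SelmerDualData κ γ := W'.selmerDualData κ hγ
  haveI : Module.Finite (IwasawaAlgebra 2) D₀'.X := D₀'.module_finite_holds hγ
  have hD₀' : D₀'.IsTorsion := h15 W' 2 hmult' f hf' κ γ hκ hγ D₀'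
  exact lengthAt_selmerDual_le_of_oddBranchInputsPrintExact_fe_of_quadraticField h12 hPE h114 h114F W W' hmult' hV hθ f κ γ hsp
    hirr hκ hγ hγ' hγθ hf I D₀' hD₀' D₀ hD₀ Lt m hLt hLt0 F hθF hF2
    (fun v hv ↦ hasSplitMultiplicativeReductionAt_baseChange_of_two_mem W' hsp' F v hv) D 𝔮 h𝔮 hp𝔮

end PrintExactDoors

end Summit.BirchSwinnertonDyer.BirchSwinnertonDyer.Theorems.AddKatoTwoQuadLayerModel

end
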